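import Literature.Computability.QuantumComplexity.MSubspaceSignReadoutRelaxedRounds
import Literature.Computability.Complexity.PCPCoins
import HarnessLib

/-!
# The M-subspace sign readout, V: the finder runs of the relaxed machine and its two acceptance laws

Proof-only analysis of `MMReadout.outR` (`MSubspaceSignReadoutRelaxed.lean`) on the code of a two-circuit
instance `I` (`f = C₀`, `g = C₁` of 𝔽₂-degree `≤ 3`, `|Φ| ≥ 3/5`), completing `MSubspaceSignReadoutRelaxedRounds`:

* the CERTIFICATE (`certOKR`) is SOUND for a cubic circuit — the second differences along two rows are affine,
  so vanishing at `0ⁿ` and the unit vectors is vanishing everywhere (an input here: the finite check handed over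
  in the form of the line's stub `stub_certify`) — and COMPLETE for rows of small rank defect spanning a
  coset-affine subspace (`certOKR_sound`, `certOKR_complete`);
* the coins: finder run `j < 6` reads block `j` (length `P`) of the coins, the answer the blocks after `6P`
  (`firstCertR_append`, `outR_prefix_append`), and the swapped instance has the same code length, value, degrees
  (`swapI_*`);
* **SAFE LAW** `cnt_outR_wrong_le`: whatever the finder is, on an instance with both circuits cubic and
  `|Φ| ≥ 3/5` at most `1/72` of the coin strings of length `coinPolyR c' pF |x|` produce the wrong sign — the
  answer is only ever given from certified rows, and then `cnt_voteN_wrong_le` applies (given the dual-value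
  identity for coset-affine subspaces, an input);
* **COMPLETE LAW** `le_cnt_outR_right`: if moreover one block of finder coins certifies with probability `≥ 2/3`
  on the instance or on its swap, the right sign is produced by at least `(26/27)(71/72) ≥ 9/10` of the coin
  strings (`cnt_firstCertR_none_le`: three independent blocks all fail with probability `≤ 1/27`);
* glue for the line's stub `stub_safeMMR`: the finder's guarantee (rows of small rank defect spanning a
  coset-affine subspace with probability `≥ 2/3`) yields certified blocks on the instance or its swap
  (`two_mul_le_cnt_certOKR`, `finder_certifies_side`), and the guard `n ≤ |x| + 1` holds as soon as `|Φ| > 1/2`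
  (`guard_of_half_lt_abs`, cf. `CubicDequant.guard_of_isYes`).

## References

* O. Goldreich, *On promise problems*, 2006, Def. 1.2 (promise-BPP). [Goldreich2006]
* S. Arora, B. Barak, *Computational Complexity: A Modern Approach*, CUP 2009, §7.4.1, Lemma A.12. [AroraBarak2009]
* C. Carlet, *Boolean Functions for Cryptography and Coding Theory*, CUP 2020, Prop. 54. [Carlet2020]
* S. Aaronson, A. Ambainis, *Forrelation*, SIAM J. Comput. 47 (2018), §1.1.1, §6. [AaronsonAmbainis2018]
-/

noncomputable section

namespace Literature.Computability.QuantumComplexity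

namespace MMReadout

open Finset Literature.Computability.Complexity Literature.Computability.Complexity.F2Elim
open Literature.Computability.Complexity.Brick (decNil)
open Literature.Computability.Complexity.LowDegree (xorVec)
open ForrCode QuadSampler CubicDequant
open BuzetChailloux (bxor zeroVec)

variable {n : ℕ}

/-! ### The certificate is sound and complete -/

/-- The rank read by the certificate is the number of pivots. [cite: Carlet2020, Prop. 54] -/
theorem npiv_eq_card_pivs (n : ℕ) (S : List Row) : npiv n S = (pivs n S).card :=
  length_filter_isPiv n S

/-- **Soundness of the relaxed certificate** (what a passing check literally says): the rank defect is small,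
and every second difference of the circuit's function along two rows vanishes at `0ⁿ` and at the unit
vectors. [cite: Carlet2020, Prop. 54] -/
theorem certOKR_sound {c' : ℕ} {C : Circuit (Fin n)} {L : List (List Bool)} (h : certOKR c' n (pcircOf C) L = true) :
    n ≤ 2 * (pivs n (rrun n L)).card + c' * Nat.log 2 (n + 2) ∧
    ∀ r ∈ L, ∀ s ∈ L, ∀ y : Fin n → Bool, (y = zeroVec ∨ ∃ i : Fin n, y = fun j => decide (j = i)) →
      (C.eval y ^^ C.eval (bxor y (fun i => r.getD i false)) ^^ C.eval (bxor y (fun i => s.getD i false)) ^^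
        C.eval (bxor y (bxor (fun i => r.getD i false) (fun i => s.getD i false)))) = false := by
  rw [certOKR, Bool.and_eq_true, decide_eq_true_eq, npiv_eq_card_pivs] at h
  refine ⟨h.1, fun r hr s hs y hy => ?_⟩
  have hall := h.2
  rw [List.all_eq_true] at hall
  have hrs := hall (r, s) (List.pair_mem_product.2 ⟨hr, hs⟩)
  rw [List.all_eq_true] at hrs
  -- the test point as a list
  obtain ⟨yl, hyl, hyv⟩ : ∃ yl ∈ unitPts n, toInput n yl = y := by
    rcases hy with rfl | ⟨i, rfl⟩
    · exact ⟨zeroL n, List.mem_cons_self, toInput_zeroL⟩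
    · refine ⟨unitL n i, List.mem_cons_of_mem _ (List.mem_map.2 ⟨i, List.mem_range.2 i.2, rfl⟩), ?_⟩
      rw [toInput_unitL]; rfl
  have hd := hrs yl hyl
  rw [Bool.not_eq_true', d2, evalP_pcircOf_eq, evalP_pcircOf_eq, evalP_pcircOf_eq, evalP_pcircOf_eq,
    toInput_bxorL, toInput_bxorL, toInput_bxorL, toInput_bxorL, hyv] at hd
  exact hd

/-- **Completeness of the relaxed certificate**: rows of rank `r` with `n ≤ 2r + c' ⌊log₂(n+2)⌋` spanning a
subspace on whose cosets the circuit's function is affine pass the check. [cite: Carlet2020, Prop. 54] -/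
theorem certOKR_complete {c' : ℕ} {C : Circuit (Fin n)} {L : List (List Bool)}
    (hrank : n ≤ 2 * Module.finrank (ZMod 2) ↥(rowSpan n L) + c' * Nat.log 2 (n + 2))
    (hM : ∀ u v : Fin n → Bool, (fun i => if u i then (1 : ZMod 2) else 0) ∈ rowSpan n L →
      (fun i => if v i then (1 : ZMod 2) else 0) ∈ rowSpan n L →
      ∀ y, (C.eval y ^^ C.eval (bxor y u) ^^ C.eval (bxor y v) ^^ C.eval (bxor y (bxor u v))) = false) :
    certOKR c' n (pcircOf C) L = true := by
  rw [certOKR, Bool.and_eq_true, decide_eq_true_eq, npiv_eq_card_pivs, ← finrank_rowSpan_eq_card_pivs]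
  refine ⟨hrank, ?_⟩
  rw [List.all_eq_true]
  rintro ⟨r, s⟩ hrs
  rw [List.pair_mem_product] at hrs
  rw [List.all_eq_true]
  intro yl _
  rw [Bool.not_eq_true', d2, evalP_pcircOf_eq, evalP_pcircOf_eq, evalP_pcircOf_eq, evalP_pcircOf_eq,
    toInput_bxorL, toInput_bxorL, toInput_bxorL, toInput_bxorL]
  exact hM _ _ ((mem_spanV_iff _).1 (toInput_mem_spanV hrs.1)) ((mem_spanV_iff _).1 (toInput_mem_spanV hrs.2)) _

/-! ### Coin bookkeeping of the finder runs -/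

variable (c' : ℕ) (find : List Bool → List Bool)

/-- Finder run `j` reads the coin block `[jP, (j+1)P)` only. [folklore] -/
theorem rowsAt_append (t : Inst) (P : ℕ) (y z : List Bool) {j : ℕ} (hj : (j + 1) * P ≤ y.length) :
    rowsAt find t P (y ++ z) j = rowsAt find t P y j := by
  rw [rowsAt, rowsAt, coinVec_append y z (by nlinarith)]

/-- `find?` only depends on the predicate on the list. [folklore] -/
theorem find?_congr_of_forall {l : List ℕ} {p q : ℕ → Bool} (h : ∀ j ∈ l, p j = q j) : l.find? p = l.find? q := by
  induction l with
  | nil => rfl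
  | cons a l ih =>
    rw [List.find?_cons, List.find?_cons, h a List.mem_cons_self, ih fun j hj => h j (List.mem_cons_of_mem _ hj)]

/-- The first certified run depends on the first `6P` coins only. [folklore] -/
theorem firstCertR_append (t : Inst) (n P : ℕ) (y z : List Bool) (hy : 6 * P ≤ y.length) :
    firstCertR c' find t n P (y ++ z) = firstCertR c' find t n P y := by
  unfold firstCertR
  refine find?_congr_of_forall fun j hj => ?_
  rw [List.mem_range] at hj
  rw [certAtR, certAtR, rowsAt_append find t P y z (by nlinarith)]

/-- A certified run is one of the six and passes the check. [folklore] -/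
theorem of_firstCertR_eq_some {t : Inst} {n P : ℕ} {y : List Bool} {j : ℕ} (h : firstCertR c' find t n P y = some j) :
    j < 6 ∧ certAtR c' find t n P y j = true := by
  unfold firstCertR at h
  exact ⟨List.mem_range.1 (List.mem_of_find?_eq_some h), List.find?_some h⟩

/-- No certified run: all six checks fail. [folklore] -/
theorem certAtR_eq_false_of_firstCertR_eq_none {t : Inst} {n P : ℕ} {y : List Bool}
    (h : firstCertR c' find t n P y = none) {j : ℕ} (hj : j < 6) : certAtR c' find t n P y j = false := by
  unfold firstCertR at h
  have := List.find?_eq_none.1 h j (List.mem_range.2 hj)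
  simpa using this

variable (pF : Polynomial ℕ)

/-- **The output after a prefix of `6P` finder coins**: with `u` of length `6 · pF ℓ` and the guard on, the relaxed
machine on `u ++ z` answers PASS if no run on `u` is certified, and otherwise the vote at offset `0` of `z` for the
circuits and rows of the first certified run on `u`. [cite: Goldreich2006, Def. 1.2] -/
theorem outR_prefix_append (t : Inst) (ℓ : ℕ) (hk : t.2.1 = 2) (hn : t.1 ≤ ℓ + 1) (u z : List Bool)
    (hu : u.length = 6 * pF.eval ℓ) :
    outR c' find pF t ℓ (u ++ z) =
      match firstCertR c' find t t.1 (pF.eval ℓ) u with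
      | none => []
      | some j => [voteN (roundsR c' t.1) t.1 (circAt (sideT t j) 0) (circAt (sideT t j) 1)
          (rrun t.1 (rowsAt find t (pF.eval ℓ) u j)) z 0] := by
  have hnEff : nEff t ℓ = t.1 := min_eq_left hn
  rw [outR, hk, hnEff]
  simp only [hn, decide_true, Bool.and_self, ite_true]
  rw [firstCertR_append c' find t t.1 (pF.eval ℓ) u z hu.ge]
  cases hfc : firstCertR c' find t t.1 (pF.eval ℓ) u with
  | none => rfl
  | some j =>
    have hj := (of_firstCertR_eq_some c' find hfc).1
    simp only [answerR]
    rw [rowsAt_append find t (pF.eval ℓ) u z (by rw [hu]; nlinarith), ← hu, voteN_shift]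

/-- Off the guard the relaxed machine passes. [cite: Goldreich2006, Def. 1.2] -/
theorem outR_of_not_guard (t : Inst) (ℓ : ℕ) (hn : ¬ t.1 ≤ ℓ + 1) (y : List Bool) : outR c' find pF t ℓ y = [] := by
  rw [outR]
  simp [hn]

/-! ### The swapped instance -/

/-- `Φ` is symmetric. [cite: AaronsonAmbainis2018, §1.1.1] -/
theorem forrelation_symm' (f g : (Fin n → Bool) → Bool) : forrelation g f = forrelation f g := by
  unfold forrelation
  congr 1
  rw [sum_comm]
  refine sum_congr rfl fun x _ => sum_congr rfl fun y _ => ?_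
  rw [twist_comm y x]; ring

/-- The swapped instance has the same value. [cite: AaronsonAmbainis2018, §1.1.1] -/
theorem value_swapI (I : KForrelationInstance) (hk : I.k = 2) : (swapI I hk).value = I.value := by
  rw [KForrelationInstance.value_eq_forrelation (swapI_k I hk), KForrelationInstance.value_eq_forrelation hk,
    swapI_C, swapI_C]
  exact forrelation_symm' _ _

/-- The swapped instance has the same code length. [cite: AaronsonAmbainis2018, §6] -/
theorem length_encode_swapI (I : KForrelationInstance) (hk : I.k = 2) :
    (swapI I hk).encode.length = I.encode.length := by
  obtain ⟨n, k, C⟩ := I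
  cases hk
  have e0 : (0 : Fin 2).rev = 1 := rfl
  have e1 : (1 : Fin 2).rev = 0 := rfl
  simp only [KForrelationInstance.encode, swapI, length_boolPair, encodeCodeList, List.ofFn_succ, List.ofFn_zero,
    List.foldr_cons, List.foldr_nil, Fin.succ_zero_eq_one, e0, e1, Fin.cast_eq_self, List.length_nil]
  omega

/-- The swapped instance is over `B₂` when the instance is. [cite: AaronsonAmbainis2018, §6] -/
theorem isOverB2_swapI {I : KForrelationInstance} (hk : I.k = 2) (h : I.IsOverB2) : (swapI I hk).IsOverB2 :=
  fun i => by rw [swapI_C]; exact h _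

/-- The swapped instance computes functions of degree `≤ 3` when the instance does. [cite: AaronsonAmbainis2018, §6] -/
theorem isDegLeFun_swapI {I : KForrelationInstance} (hk : I.k = 2) (h : ∀ i, IsDegLeFun 3 (I.C i).eval) (i : Fin 2) :
    IsDegLeFun 3 ((swapI I hk).C i).eval := by
  rw [swapI_C]; exact h _

/-- The circuits of the swapped mirror. [folklore] -/
theorem circAt_swapT (t : Inst) : circAt (swapT t) 0 = circAt t 1 ∧ circAt (swapT t) 1 = circAt t 0 := ⟨rfl, rfl⟩

/-- The code of the swapped mirror of `I` is the code of the swapped instance. [cite: AaronsonAmbainis2018, §6] -/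
theorem instE_swapT_instOf (I : KForrelationInstance) (hk : I.k = 2) :
    instE (swapT (instOf I)) = (swapI I hk).encode := by
  rw [← instOf_swapI I hk, ← encode_eq]


/-! ### Coin slices as take/drop, and small counting facts -/

/-- A coin slice inside the string is a `take` of a `drop`. [folklore] -/
theorem coinVec_eq_take_drop (u : List Bool) {m off : ℕ} (h : off + m ≤ u.length) :
    coinVec u m off = (u.drop off).take m := by
  apply List.ext_getElem
  · simp [coinVec]; omega
  · intro i h1 h2
    simp only [coinVec, List.getElem_map, List.getElem_range, List.getElem_take, List.getElem_drop]
    rw [List.getD_eq_getElem]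

/-- A Boolean statistic splits the coin strings into its two level sets. [folklore] -/
theorem cnt_eq_add_cnt_eq_not (m : ℕ) (F : List Bool → Bool) (b : Bool) :
    cnt m {y | F y = b} + cnt m {y | F y = !b} = 2 ^ m := by
  rw [← cnt_add_cnt_compl m {y | F y = b}]
  congr 1
  refine cnt_congr fun y _ => ?_
  simp only [Set.mem_setOf_eq, Set.mem_compl_iff]
  cases F y <;> cases b <;> simp

/-! ### SAFE: the vote fibre of a certified run -/

section Fibre

variable {c'}
variable {A B : Circuit (Fin n)}
  (hcertB : ∀ L : List (List Bool),
    (∀ r ∈ L, ∀ s ∈ L, ∀ y : Fin n → Bool, (y = zeroVec ∨ ∃ i : Fin n, y = fun j => decide (j = i)) →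
      (B.eval y ^^ B.eval (bxor y (fun i => r.getD i false)) ^^ B.eval (bxor y (fun i => s.getD i false)) ^^
        B.eval (bxor y (bxor (fun i => r.getD i false) (fun i => s.getD i false)))) = false) →
    ∀ u v : Fin n → Bool, (fun i => if u i then (1 : ZMod 2) else 0) ∈ rowSpan n L →
      (fun i => if v i then (1 : ZMod 2) else 0) ∈ rowSpan n L →
    ∀ y, (B.eval y ^^ B.eval (bxor y u) ^^ B.eval (bxor y v) ^^ B.eval (bxor y (bxor u v))) = false)
  (hdualAB : ∀ V : Finset (Fin n → Bool), zeroVec ∈ V → (∀ x ∈ V, ∀ y ∈ V, bxor x y ∈ V) →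
    (∀ u ∈ V, ∀ v ∈ V, ∀ y, (B.eval y ^^ B.eval (bxor y u) ^^ B.eval (bxor y v) ^^ B.eval (bxor y (bxor u v))) = false) →
    ∑ z : Fin n → Bool, ∑ x ∈ univ.filter (fun x => ∀ v ∈ V, twist x v = signOf (B.eval (bxor z v)) * signOf (B.eval z)),
        signOf (A.eval x) * signOf (B.eval z) * twist x z = Real.sqrt (2 ^ (3 * n)) * forrelation A.eval B.eval)
  (hΦ : 3 / 5 ≤ |forrelation A.eval B.eval|)

include hcertB hdualAB hΦ in
/-- **The vote fibre of a certified run is mostly right.** For cubic circuits `A`, `B` (functions `a`, `b`) with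
`|Φ(a,b)| ≥ 3/5`, rows `L` certified for `B`, and `d ≥ 2n · roundsR c' n` sampler coins: at most `2^d / 72` of the
coin strings of length `d` make the vote (offset `0`) disagree with the sign of `Φ(a,b)` — the certificate makes `b`
affine on the cosets of `spanV n L` (`hcertB`, the finite check), the dual-value identity (`hdualAB`) gives the mean,
and `cnt_voteN_wrong_le` applies. [cite: AroraBarak2009, Lemma A.12 and §7.4.1] -/
theorem cnt_vote_fibre_wrong_le {L : List (List Bool)} (hL : certOKR c' n (pcircOf B) L = true) {d : ℕ}
    (hd : roundsR c' n * (2 * n) ≤ d) :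
    72 * (cnt d {z | voteN (roundsR c' n) n (pcircOf A) (pcircOf B) (rrun n L) z 0 =
        decide (forrelation A.eval B.eval < 0)} : ℝ) ≤ 2 ^ d := by
  obtain ⟨hrank, htest⟩ := certOKR_sound hL
  have hMrow := hcertB L htest
  have hM : ∀ u ∈ spanV n L, ∀ v ∈ spanV n L, ∀ y,
      (B.eval y ^^ B.eval (bxor y u) ^^ B.eval (bxor y v) ^^ B.eval (bxor y (bxor u v))) = false :=
    fun u hu v hv => hMrow u v ((mem_spanV_iff u).1 hu) ((mem_spanV_iff v).1 hv)
  have hdual := hdualAB (spanV n L) (zeroVec_mem_spanV L) (fun x hx y hy => bxor_mem_spanV hx hy) hM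
  have h72 := cnt_voteN_wrong_le (c' := c') (evalP_pcircOf_eq A) (evalP_pcircOf_eq B) hM hdual hrank hΦ
  obtain ⟨e, rfl⟩ := Nat.exists_eq_add_of_le hd
  rw [cnt_prefix _ e _ (fun y z hy => by
    simp only [Set.mem_setOf_eq]
    rw [voteN_append _ _ _ _ _ y z hy.ge]), pow_add]
  push_cast
  rw [show 2 * n * roundsR c' n = roundsR c' n * (2 * n) by ring] at h72
  nlinarith [h72, pow_pos (show (0:ℝ) < 2 from two_pos) e]

include hcertB hdualAB hΦ in
/-- … hence at least `71/72` of them give the right sign. [cite: AroraBarak2009, §7.4.1] -/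
theorem le_cnt_vote_fibre_right {L : List (List Bool)} (hL : certOKR c' n (pcircOf B) L = true) {d : ℕ}
    (hd : roundsR c' n * (2 * n) ≤ d) :
    71 * (2 : ℝ) ^ d ≤ 72 * (cnt d {z | voteN (roundsR c' n) n (pcircOf A) (pcircOf B) (rrun n L) z 0 =
        decide (0 < forrelation A.eval B.eval)} : ℝ) := by
  have hw := cnt_vote_fibre_wrong_le hcertB hdualAB hΦ hL hd
  have hΦ0 : forrelation A.eval B.eval ≠ 0 := fun h => by rw [h, abs_zero] at hΦ; norm_num at hΦ
  have hb : decide (0 < forrelation A.eval B.eval) = !decide (forrelation A.eval B.eval < 0) := by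
    rcases lt_or_gt_of_ne hΦ0 with h | h
    · rw [decide_eq_true h, decide_eq_false (not_lt.2 h.le)]; rfl
    · rw [decide_eq_false (not_lt.2 h.le), decide_eq_true h]; rfl
  have htot := cnt_eq_add_cnt_eq_not d (fun z => voteN (roundsR c' n) n (pcircOf A) (pcircOf B) (rrun n L) z 0)
    (decide (forrelation A.eval B.eval < 0))
  rw [← hb] at htot
  have htot' : (cnt d {z | voteN (roundsR c' n) n (pcircOf A) (pcircOf B) (rrun n L) z 0 =
      decide (forrelation A.eval B.eval < 0)} : ℝ) + cnt d {z | voteN (roundsR c' n) n (pcircOf A) (pcircOf B) (rrun n L) z 0 =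
      decide (0 < forrelation A.eval B.eval)} = 2 ^ d := by exact_mod_cast htot
  linarith

end Fibre


/-! ### The instance: its mirror, its sides, its functions -/

section Instance

variable (I : KForrelationInstance) (hk : I.k = 2)

/-- Runs `0, 1, 2` use the instance itself. [folklore] -/
theorem sideT_of_lt (t : Inst) {j : ℕ} (hj : j < 3) : sideT t j = t := by simp [sideT, hj]

/-- Runs `3, 4, 5` use the swapped instance. [folklore] -/
theorem sideT_of_le (t : Inst) {j : ℕ} (hj : 3 ≤ j) : sideT t j = swapT t := by simp [sideT, not_lt.2 hj]

/-- The finder input of runs `0, 1, 2` is the code of the instance. [cite: AaronsonAmbainis2018, §6] -/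
theorem instE_sideT_of_lt {j : ℕ} (hj : j < 3) : instE (sideT (instOf I) j) = I.encode := by
  rw [sideT_of_lt _ hj, ← encode_eq]

/-- The finder input of runs `3, 4, 5` is the code of the swapped instance. [cite: AaronsonAmbainis2018, §6] -/
theorem instE_sideT_of_le {j : ℕ} (hj : 3 ≤ j) : instE (sideT (instOf I) j) = (swapI I hk).encode := by
  rw [sideT_of_le _ hj, instE_swapT_instOf I hk]

/-- The circuits of runs `0, 1, 2`: `(C₀, C₁)`. [folklore] -/
theorem circAt_sideT_of_lt {j : ℕ} (hj : j < 3) :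
    circAt (sideT (instOf I) j) 0 = pcircOf (C₀ I hk) ∧ circAt (sideT (instOf I) j) 1 = pcircOf (C₁ I hk) := by
  rw [sideT_of_lt _ hj]; exact ⟨circAt_zero I hk, circAt_one I hk⟩

/-- The circuits of runs `3, 4, 5`: `(C₁, C₀)`. [folklore] -/
theorem circAt_sideT_of_le {j : ℕ} (hj : 3 ≤ j) :
    circAt (sideT (instOf I) j) 0 = pcircOf (C₁ I hk) ∧ circAt (sideT (instOf I) j) 1 = pcircOf (C₀ I hk) := by
  rw [sideT_of_le _ hj, (circAt_swapT _).1, (circAt_swapT _).2]; exact ⟨circAt_one I hk, circAt_zero I hk⟩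

/-! ### COMPLETE: three independent finder blocks rarely all fail -/

include hk in
/-- **No certified run is rare.** If one block of finder coins certifies with probability `≥ 2/3` — on the
instance (its runs are `0,1,2`) or on its swap (runs `3,4,5`) — then all six runs fail on at most `1/27` of the
strings of `6P` finder coins: the three relevant runs read three disjoint blocks (`cnt_take_drop`).
[cite: AroraBarak2009, §7.4.1] -/
theorem cnt_firstCertR_none_le (P : ℕ)
    (hfind : 2 * 2 ^ P ≤ 3 * cnt P {y | certOKR c' I.n (pcircOf (C₁ I hk)) (decNil (find (boolPair I.encode y))) = true} ∨
      2 * 2 ^ P ≤ 3 * cnt P {y | certOKR c' I.n (pcircOf (C₀ I hk)) (decNil (find (boolPair (swapI I hk).encode y))) = true}) :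
    27 * cnt (6 * P) {u | firstCertR c' find (instOf I) I.n P u = none} ≤ 2 ^ (6 * P) := by
  -- the bad block values of a side, and their number
  have hbad : ∀ (C : Circuit (Fin I.n)) (x : List Bool),
      2 * 2 ^ P ≤ 3 * cnt P {y | certOKR c' I.n (pcircOf C) (decNil (find (boolPair x y))) = true} →
      3 * cnt P {y | certOKR c' I.n (pcircOf C) (decNil (find (boolPair x y))) = false} ≤ 2 ^ P := by
    intro C x h
    have := cnt_eq_add_cnt_eq_not P (fun y => certOKR c' I.n (pcircOf C) (decNil (find (boolPair x y)))) true
    simp only [Bool.not_true] at this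
    omega
  -- a failed run `j` puts block `j` in the bad set of its side
  have hrun : ∀ (u : List Bool) (j : ℕ), u.length = 6 * P → j < 6 → certAtR c' find (instOf I) I.n P u j = false →
      certOKR c' I.n (circAt (sideT (instOf I) j) 1)
        (decNil (find (boolPair (instE (sideT (instOf I) j)) ((u.drop (j * P)).take P)))) = false := by
    intro u j hu hj h
    rwa [certAtR, rowsAt, coinVec_eq_take_drop u (by rw [hu]; nlinarith)] at h
  rcases hfind with hgood | hgood
  · -- runs 0, 1, 2 on the instance
    set Bd := {y : List Bool | certOKR c' I.n (pcircOf (C₁ I hk)) (decNil (find (boolPair I.encode y))) = false} with hBd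
    have hB := hbad _ _ hgood
    have hsub : ∀ u : List Bool, u.length = 6 * P → u ∈ {u | firstCertR c' find (instOf I) I.n P u = none} →
        u ∈ {u : List Bool | u.take P ∈ Bd ∧ u.drop P ∈
          {u₁ : List Bool | u₁.take P ∈ Bd ∧ u₁.drop P ∈ {u₂ : List Bool | u₂.take P ∈ Bd ∧ u₂.drop P ∈ (Set.univ : Set (List Bool))}}} := by
      intro u hu hnone
      have h0 := hrun u 0 hu (by norm_num) (certAtR_eq_false_of_firstCertR_eq_none c' find hnone (by norm_num))
      have h1 := hrun u 1 hu (by norm_num) (certAtR_eq_false_of_firstCertR_eq_none c' find hnone (by norm_num))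
      have h2 := hrun u 2 hu (by norm_num) (certAtR_eq_false_of_firstCertR_eq_none c' find hnone (by norm_num))
      rw [(circAt_sideT_of_lt I hk (by norm_num)).2, instE_sideT_of_lt I (by norm_num)] at h0 h1 h2
      simp only [Set.mem_setOf_eq, Set.mem_univ, and_true, hBd]
      rw [zero_mul, List.drop_zero] at h0
      rw [one_mul] at h1
      rw [List.drop_drop, show P + P = 2 * P by ring]
      exact ⟨h0, h1, h2⟩
    have hmono := PCPCoins.cnt_mono hsub
    have hsplit : 6 * P = P + (P + (P + 3 * P)) := by ring
    rw [hsplit] at hmono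
    rw [cnt_take_drop, cnt_take_drop, cnt_take_drop, cnt_univ] at hmono
    rw [hsplit]
    calc 27 * cnt (P + (P + (P + 3 * P))) {u | firstCertR c' find (instOf I) I.n P u = none}
        ≤ 27 * (cnt P Bd * (cnt P Bd * (cnt P Bd * 2 ^ (3 * P)))) := Nat.mul_le_mul_left _ hmono
      _ = (3 * cnt P Bd) ^ 3 * 2 ^ (3 * P) := by ring
      _ ≤ (2 ^ P) ^ 3 * 2 ^ (3 * P) := Nat.mul_le_mul_right _ (Nat.pow_le_pow_left hB 3)
      _ = 2 ^ (P + (P + (P + 3 * P))) := by rw [← pow_mul, ← pow_add]; ring_nf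
  · -- runs 3, 4, 5 on the swapped instance
    set Bd := {y : List Bool | certOKR c' I.n (pcircOf (C₀ I hk)) (decNil (find (boolPair (swapI I hk).encode y))) = false}
      with hBd
    have hB := hbad _ _ hgood
    have hsub : ∀ u : List Bool, u.length = 6 * P → u ∈ {u | firstCertR c' find (instOf I) I.n P u = none} →
        u ∈ {u : List Bool | u.take (3 * P) ∈ (Set.univ : Set (List Bool)) ∧ u.drop (3 * P) ∈
          {u₃ : List Bool | u₃.take P ∈ Bd ∧ u₃.drop P ∈ {u₄ : List Bool | u₄.take P ∈ Bd ∧ u₄.drop P ∈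
            {u₅ : List Bool | u₅.take P ∈ Bd ∧ u₅.drop P ∈ (Set.univ : Set (List Bool))}}}} := by
      intro u hu hnone
      have h3 := hrun u 3 hu (by norm_num) (certAtR_eq_false_of_firstCertR_eq_none c' find hnone (by norm_num))
      have h4 := hrun u 4 hu (by norm_num) (certAtR_eq_false_of_firstCertR_eq_none c' find hnone (by norm_num))
      have h5 := hrun u 5 hu (by norm_num) (certAtR_eq_false_of_firstCertR_eq_none c' find hnone (by norm_num))
      rw [(circAt_sideT_of_le I hk (by norm_num)).2, instE_sideT_of_le I hk (by norm_num)] at h3 h4 h5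
      simp only [Set.mem_setOf_eq, Set.mem_univ, and_true, true_and, hBd]
      rw [List.drop_drop, List.drop_drop, show 3 * P + P = 4 * P by ring, show 4 * P + P = 5 * P by ring]
      exact ⟨h3, h4, h5⟩
    have hmono := PCPCoins.cnt_mono hsub
    have hsplit : 6 * P = 3 * P + (P + (P + (P + 0))) := by ring
    rw [hsplit] at hmono
    rw [cnt_take_drop, cnt_take_drop, cnt_take_drop, cnt_take_drop, cnt_univ, cnt_univ] at hmono
    rw [hsplit]
    calc 27 * cnt (3 * P + (P + (P + (P + 0)))) {u | firstCertR c' find (instOf I) I.n P u = none}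
        ≤ 27 * (2 ^ (3 * P) * (cnt P Bd * (cnt P Bd * (cnt P Bd * 2 ^ 0)))) := Nat.mul_le_mul_left _ hmono
      _ = (3 * cnt P Bd) ^ 3 * 2 ^ (3 * P) := by ring
      _ ≤ (2 ^ P) ^ 3 * 2 ^ (3 * P) := Nat.mul_le_mul_right _ (Nat.pow_le_pow_left hB 3)
      _ = 2 ^ (3 * P + (P + (P + (P + 0)))) := by rw [← pow_mul, ← pow_add]; ring_nf

end Instance


/-! ### The two laws on an instance -/

/-- No coins of length `m` lie in the empty event. [folklore] -/
theorem cnt_empty (m : ℕ) : cnt m (∅ : Set (List Bool)) = 0 := by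
  classical
  unfold cnt; simp

/-- Counting an event by summing its indicator over the coin vectors. [folklore] -/
theorem sum_ite_eq_cnt (m : ℕ) (p : List Bool → Prop) [DecidablePred p] :
    ∑ u : List.Vector Bool m, (if p u.toList then (1 : ℝ) else 0) = cnt m {w | p w} := by
  classical
  rw [Finset.sum_boole]
  unfold cnt
  simp only [Set.mem_setOf_eq]

section Laws

variable (I : KForrelationInstance) (hk : I.k = 2)
  (hdual : ∀ (f g : (Fin I.n → Bool) → Bool) (V : Finset (Fin I.n → Bool)),
      zeroVec ∈ V → (∀ x ∈ V, ∀ y ∈ V, bxor x y ∈ V) →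
      (∀ u ∈ V, ∀ v ∈ V, ∀ y, (g y ^^ g (bxor y u) ^^ g (bxor y v) ^^ g (bxor y (bxor u v))) = false) →
      ∑ z : Fin I.n → Bool, ∑ x ∈ univ.filter (fun x => ∀ v ∈ V, twist x v = signOf (g (bxor z v)) * signOf (g z)),
          signOf (f x) * signOf (g z) * twist x z = Real.sqrt (2 ^ (3 * I.n)) * forrelation f g)
  (hcert : ∀ (g : (Fin I.n → Bool) → Bool), IsDegLeFun 3 g → ∀ L : List (List Bool),
      (∀ r ∈ L, ∀ s ∈ L, ∀ y : Fin I.n → Bool, (y = zeroVec ∨ ∃ i : Fin I.n, y = fun j => decide (j = i)) →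
        (g y ^^ g (bxor y (fun i => r.getD i false)) ^^ g (bxor y (fun i => s.getD i false)) ^^
          g (bxor y (bxor (fun i => r.getD i false) (fun i => s.getD i false)))) = false) →
      ∀ u v : Fin I.n → Bool, (fun i => if u i then (1 : ZMod 2) else 0) ∈ rowSpan I.n L →
        (fun i => if v i then (1 : ZMod 2) else 0) ∈ rowSpan I.n L →
      ∀ y, (g y ^^ g (bxor y u) ^^ g (bxor y v) ^^ g (bxor y (bxor u v))) = false)
  (hdeg : ∀ i, IsDegLeFun 3 (I.C i).eval) (hΦ : 3 / 5 ≤ |I.value|)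

include hk hdual hcert hdeg hΦ in
/-- **The vote fibre of a certified run on the instance**: for the first certified run `j` (circuits of side `j`,
certified rows `L`) and `d ≥ 2n · roundsR c' n`, at most `2^d/72` of the sampler coin strings vote against the
sign of `Φ`, and at least `71 · 2^d / 72` for it. [cite: AroraBarak2009, §7.4.1] -/
theorem vote_fibre_bounds {j : ℕ} {L : List (List Bool)}
    (hL : certOKR c' I.n (circAt (sideT (instOf I) j) 1) L = true) {d : ℕ} (hd : roundsR c' I.n * (2 * I.n) ≤ d) :
    72 * (cnt d {z | voteN (roundsR c' I.n) I.n (circAt (sideT (instOf I) j) 0) (circAt (sideT (instOf I) j) 1)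
        (rrun I.n L) z 0 = decide (I.value < 0)} : ℝ) ≤ 2 ^ d ∧
    71 * (2 : ℝ) ^ d ≤ 72 * (cnt d {z | voteN (roundsR c' I.n) I.n (circAt (sideT (instOf I) j) 0)
        (circAt (sideT (instOf I) j) 1) (rrun I.n L) z 0 = decide (0 < I.value)} : ℝ) := by
  have hf3 : IsDegLeFun 3 (fI I hk) := hdeg _
  have hg3 : IsDegLeFun 3 (gI I hk) := hdeg _
  have hΦfg : 3 / 5 ≤ |forrelation (fI I hk) (gI I hk)| := by rw [← value_eq_forrelation_fg I hk]; exact hΦ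
  have hΦgf : 3 / 5 ≤ |forrelation (gI I hk) (fI I hk)| := by rw [forrelation_symm']; exact hΦfg
  by_cases hj3 : j < 3
  · rw [(circAt_sideT_of_lt I hk hj3).2] at hL
    rw [(circAt_sideT_of_lt I hk hj3).1, (circAt_sideT_of_lt I hk hj3).2, value_eq_forrelation_fg I hk]
    exact ⟨cnt_vote_fibre_wrong_le (A := C₀ I hk) (B := C₁ I hk) (hcert (gI I hk) hg3) (hdual (fI I hk) (gI I hk)) hΦfg hL hd,
      le_cnt_vote_fibre_right (A := C₀ I hk) (B := C₁ I hk) (hcert (gI I hk) hg3) (hdual (fI I hk) (gI I hk)) hΦfg hL hd⟩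
  · have hj3' : 3 ≤ j := not_lt.1 hj3
    rw [(circAt_sideT_of_le I hk hj3').2] at hL
    rw [(circAt_sideT_of_le I hk hj3').1, (circAt_sideT_of_le I hk hj3').2, value_eq_forrelation_fg I hk,
      ← forrelation_symm' (fI I hk) (gI I hk)]
    exact ⟨cnt_vote_fibre_wrong_le (A := C₁ I hk) (B := C₀ I hk) (hcert (fI I hk) hf3) (hdual (gI I hk) (fI I hk)) hΦgf hL hd,
      le_cnt_vote_fibre_right (A := C₁ I hk) (B := C₀ I hk) (hcert (fI I hk) hf3) (hdual (gI I hk) (fI I hk)) hΦgf hL hd⟩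

include hk hdual hcert hdeg hΦ in
/-- **SAFE LAW of the relaxed readout machine.** On a two-circuit instance whose circuits compute cubic functions
with `|Φ| ≥ 3/5`, whatever the finder `find`, at most `1/72` of the coin strings of length `coinPolyR c' pF |x|`
make the machine output the WRONG sign `[Φ < 0]` (it answers only from certified rows). Inputs: the dual-value
identity for coset-affine subspaces (`hdual`) and the finite affine-ness check for cubics (`hcert`).
[cite: Goldreich2006, Def. 1.2] -/
theorem cnt_outR_wrong_le :
    72 * (cnt ((coinPolyR c' pF).eval I.encode.length)
        {y | outR c' find pF (instOf I) I.encode.length y = [decide (I.value < 0)]} : ℝ) ≤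
      2 ^ (coinPolyR c' pF).eval I.encode.length := by
  set ℓ := I.encode.length with hℓ
  by_cases hguard : I.n ≤ ℓ + 1
  · rw [coinPolyR_eval, PCPCoins.cnt_add_eq_sum_prefix]
    set P := pF.eval ℓ with hP
    set d := 2 * roundsR c' (ℓ + 1) * (ℓ + 1) with hdd
    have hd : roundsR c' I.n * (2 * I.n) ≤ d := by
      rw [hdd, mul_comm 2 (roundsR c' (ℓ + 1)), mul_assoc]
      exact Nat.mul_le_mul (roundsR_mono c' hguard) (by omega)
    have hk' : (instOf I).2.1 = 2 := hk
    have hfib : ∀ u : List.Vector Bool (6 * P),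
        72 * (cnt d {z | u.toList ++ z ∈ {y | outR c' find pF (instOf I) ℓ y = [decide (I.value < 0)]}} : ℝ) ≤ 2 ^ d := by
      intro u
      have hu : u.toList.length = 6 * pF.eval ℓ := by rw [← hP]; exact u.toList_length
      have hout := outR_prefix_append c' find pF (instOf I) ℓ hk' hguard u.toList
      cases hfc : firstCertR c' find (instOf I) (instOf I).1 (pF.eval ℓ) u.toList with
      | none =>
        have hset : {z : List Bool | u.toList ++ z ∈ {y | outR c' find pF (instOf I) ℓ y = [decide (I.value < 0)]}} = ∅ := by
          ext z
          simp only [Set.mem_setOf_eq, Set.mem_empty_iff_false, iff_false]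
          rw [hout z hu, hfc]
          simp
        rw [hset, cnt_empty]; simp
      | some j =>
        obtain ⟨-, hcj⟩ := of_firstCertR_eq_some c' find hfc
        have hset : {z : List Bool | u.toList ++ z ∈ {y | outR c' find pF (instOf I) ℓ y = [decide (I.value < 0)]}} =
            {z | voteN (roundsR c' I.n) I.n (circAt (sideT (instOf I) j) 0) (circAt (sideT (instOf I) j) 1)
              (rrun I.n (rowsAt find (instOf I) (pF.eval ℓ) u.toList j)) z 0 = decide (I.value < 0)} := by
          ext z
          simp only [Set.mem_setOf_eq]
          rw [hout z hu, hfc]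
          simp only [List.cons.injEq, and_true]
          rfl
        rw [hset]
        exact (vote_fibre_bounds c' I hk hdual hcert hdeg hΦ hcj hd).1
    calc 72 * (((∑ u : List.Vector Bool (6 * P),
          cnt d {z | u.toList ++ z ∈ {y | outR c' find pF (instOf I) ℓ y = [decide (I.value < 0)]}} : ℕ) : ℝ))
        = ∑ u : List.Vector Bool (6 * P),
            72 * (cnt d {z | u.toList ++ z ∈ {y | outR c' find pF (instOf I) ℓ y = [decide (I.value < 0)]}} : ℝ) := by
          push_cast; rw [mul_sum]
      _ ≤ ∑ _u : List.Vector Bool (6 * P), (2 : ℝ) ^ d := sum_le_sum fun u _ => hfib u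
      _ = 2 ^ (6 * P + d) := by
          rw [sum_const, card_univ, card_vector, Fintype.card_bool, nsmul_eq_mul, pow_add]; push_cast; ring
  · have hset : {y : List Bool | outR c' find pF (instOf I) ℓ y = [decide (I.value < 0)]} = ∅ := by
      ext y
      simp only [Set.mem_setOf_eq, Set.mem_empty_iff_false, iff_false]
      rw [outR_of_not_guard c' find pF (instOf I) ℓ hguard]
      simp
    rw [hset, cnt_empty]; simp

include hk hdual hcert hdeg hΦ in
/-- **COMPLETE LAW of the relaxed readout machine.** If moreover the guard holds and one block of finder coins
certifies with probability `≥ 2/3` on the instance or on its swap, then at least `9/10` of the coin strings of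
length `coinPolyR c' pF |x|` make the machine output the RIGHT sign `[0 < Φ]`: all three relevant finder runs fail
on `≤ 1/27` of the finder coins, a certified run votes wrongly on `≤ 1/72` of the sampler coins, and
`(26/27)(71/72) ≥ 9/10`. [cite: Goldreich2006, Def. 1.2] -/
theorem le_cnt_outR_right (hguard : I.n ≤ I.encode.length + 1)
    (hfind : 2 * 2 ^ pF.eval I.encode.length ≤ 3 * cnt (pF.eval I.encode.length)
        {y | certOKR c' I.n (pcircOf (C₁ I hk)) (decNil (find (boolPair I.encode y))) = true} ∨
      2 * 2 ^ pF.eval I.encode.length ≤ 3 * cnt (pF.eval I.encode.length)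
        {y | certOKR c' I.n (pcircOf (C₀ I hk)) (decNil (find (boolPair (swapI I hk).encode y))) = true}) :
    9 * (2 : ℝ) ^ (coinPolyR c' pF).eval I.encode.length ≤
      10 * cnt ((coinPolyR c' pF).eval I.encode.length)
        {y | outR c' find pF (instOf I) I.encode.length y = [decide (0 < I.value)]} := by
  set ℓ := I.encode.length with hℓ
  rw [coinPolyR_eval, PCPCoins.cnt_add_eq_sum_prefix]
  set P := pF.eval ℓ with hP
  set d := 2 * roundsR c' (ℓ + 1) * (ℓ + 1) with hdd
  have hd : roundsR c' I.n * (2 * I.n) ≤ d := by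
    rw [hdd, mul_comm 2 (roundsR c' (ℓ + 1)), mul_assoc]
    exact Nat.mul_le_mul (roundsR_mono c' hguard) (by omega)
  have hk' : (instOf I).2.1 = 2 := hk
  -- per finder prefix: a certified run gives the right answer on ≥ 71/72 of the sampler coins
  have hfib : ∀ u : List.Vector Bool (6 * P),
      71 * (2 : ℝ) ^ d * (if firstCertR c' find (instOf I) I.n P u.toList = none then 0 else 1) ≤
        72 * (cnt d {z | u.toList ++ z ∈ {y | outR c' find pF (instOf I) ℓ y = [decide (0 < I.value)]}} : ℝ) := by
    intro u
    have hu : u.toList.length = 6 * pF.eval ℓ := by rw [← hP]; exact u.toList_length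
    have hout := outR_prefix_append c' find pF (instOf I) ℓ hk' hguard u.toList
    cases hfc : firstCertR c' find (instOf I) (instOf I).1 (pF.eval ℓ) u.toList with
    | none =>
      rw [show firstCertR c' find (instOf I) I.n P u.toList = none from hfc, if_pos rfl, mul_zero]
      positivity
    | some j =>
      rw [show firstCertR c' find (instOf I) I.n P u.toList = some j from hfc]
      simp only [reduceCtorEq, ite_false, mul_one]
      obtain ⟨-, hcj⟩ := of_firstCertR_eq_some c' find hfc
      have hset : {z : List Bool | u.toList ++ z ∈ {y | outR c' find pF (instOf I) ℓ y = [decide (0 < I.value)]}} =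
          {z | voteN (roundsR c' I.n) I.n (circAt (sideT (instOf I) j) 0) (circAt (sideT (instOf I) j) 1)
            (rrun I.n (rowsAt find (instOf I) (pF.eval ℓ) u.toList j)) z 0 = decide (0 < I.value)} := by
        ext z
        simp only [Set.mem_setOf_eq]
        rw [hout z hu, hfc]
        simp only [List.cons.injEq, and_true]
        rfl
      rw [hset]
      exact (vote_fibre_bounds c' I hk hdual hcert hdeg hΦ hcj hd).2
  -- the finder prefixes without a certified run are ≤ 1/27 of all
  have hnone := cnt_firstCertR_none_le c' find I hk P hfind
  have hnoneR : 27 * (cnt (6 * P) {u | firstCertR c' find (instOf I) I.n P u = none} : ℝ) ≤ 2 ^ (6 * P) := by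
    exact_mod_cast hnone
  have hind : ∑ u : List.Vector Bool (6 * P), (if firstCertR c' find (instOf I) I.n P u.toList = none then (1 : ℝ) else 0) =
      cnt (6 * P) {u | firstCertR c' find (instOf I) I.n P u = none} :=
    sum_ite_eq_cnt (6 * P) (fun w => firstCertR c' find (instOf I) I.n P w = none)
  have hsum := sum_le_sum fun u (_ : u ∈ (univ : Finset (List.Vector Bool (6 * P)))) => hfib u
  rw [← mul_sum, ← mul_sum] at hsum
  have hflip : ∑ u : List.Vector Bool (6 * P), (if firstCertR c' find (instOf I) I.n P u.toList = none then (0 : ℝ) else 1) =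
      2 ^ (6 * P) - cnt (6 * P) {u | firstCertR c' find (instOf I) I.n P u = none} := by
    rw [← hind, eq_sub_iff_add_eq, ← sum_add_distrib]
    have : ∀ u : List.Vector Bool (6 * P), ((if firstCertR c' find (instOf I) I.n P u.toList = none then (0 : ℝ) else 1) +
        if firstCertR c' find (instOf I) I.n P u.toList = none then (1 : ℝ) else 0) = 1 := fun u => by
      split_ifs <;> norm_num
    rw [sum_congr rfl fun u _ => this u, sum_const, card_univ, card_vector, Fintype.card_bool, nsmul_eq_mul, mul_one]
    push_cast; rfl
  rw [hflip] at hsum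
  rw [pow_add]
  push_cast
  have h2P : (0 : ℝ) ≤ 2 ^ (6 * P) := by positivity
  have h2d : (0 : ℝ) ≤ 2 ^ d := by positivity
  nlinarith [hsum, hnoneR, mul_nonneg h2P h2d]

end Laws


/-! ### From the finder's guarantee to certified blocks; the guard -/

/-- **A successful finder run certifies**: if on at least `2/3` of the coin strings of length `P` the finder returns
the code of rows of rank defect `≤ c' ⌊log₂(n+2)⌋` spanning a subspace on whose cosets the circuit's function is
affine, then at least `2/3` of them pass the relaxed certificate. [cite: Carlet2020, Prop. 54] -/
theorem two_mul_le_cnt_certOKR {c' : ℕ} (find : List Bool → List Bool) {C : Circuit (Fin n)} {x : List Bool} {P : ℕ}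
    (h : (2 / 3 : ℝ) ≤ uniformProb P {y | ∃ L : List (List Bool), find (boolPair x y) = encList L ∧
      n ≤ 2 * Module.finrank (ZMod 2) ↥(rowSpan n L) + c' * Nat.log 2 (n + 2) ∧
      ∀ u v : Fin n → Bool, (fun i => if u i then (1 : ZMod 2) else 0) ∈ rowSpan n L →
        (fun i => if v i then (1 : ZMod 2) else 0) ∈ rowSpan n L →
      ∀ y, (C.eval y ^^ C.eval (bxor y u) ^^ C.eval (bxor y v) ^^ C.eval (bxor y (bxor u v))) = false}) :
    2 * 2 ^ P ≤ 3 * cnt P {y | certOKR c' n (pcircOf C) (decNil (find (boolPair x y))) = true} := by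
  have hmono : cnt P {y | ∃ L : List (List Bool), find (boolPair x y) = encList L ∧
      n ≤ 2 * Module.finrank (ZMod 2) ↥(rowSpan n L) + c' * Nat.log 2 (n + 2) ∧
      ∀ u v : Fin n → Bool, (fun i => if u i then (1 : ZMod 2) else 0) ∈ rowSpan n L →
        (fun i => if v i then (1 : ZMod 2) else 0) ∈ rowSpan n L →
      ∀ y, (C.eval y ^^ C.eval (bxor y u) ^^ C.eval (bxor y v) ^^ C.eval (bxor y (bxor u v))) = false} ≤
      cnt P {y | certOKR c' n (pcircOf C) (decNil (find (boolPair x y))) = true} := by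
    refine PCPCoins.cnt_mono fun y _ hy => ?_
    obtain ⟨L, hL, hrank, hM⟩ := hy
    simp only [Set.mem_setOf_eq]
    rw [hL, Brick.decNil_encList]
    exact certOKR_complete hrank hM
  rw [uniformProb_eq_cnt_div, le_div_iff₀ (by positivity)] at h
  have h' : (2 : ℝ) * 2 ^ P ≤ 3 * cnt P {y | certOKR c' n (pcircOf C) (decNil (find (boolPair x y))) = true} := by
    have hm : (cnt P {y | ∃ L : List (List Bool), find (boolPair x y) = encList L ∧
      n ≤ 2 * Module.finrank (ZMod 2) ↥(rowSpan n L) + c' * Nat.log 2 (n + 2) ∧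
      ∀ u v : Fin n → Bool, (fun i => if u i then (1 : ZMod 2) else 0) ∈ rowSpan n L →
        (fun i => if v i then (1 : ZMod 2) else 0) ∈ rowSpan n L →
      ∀ y, (C.eval y ^^ C.eval (bxor y u) ^^ C.eval (bxor y v) ^^ C.eval (bxor y (bxor u v))) = false} : ℝ) ≤
      cnt P {y | certOKR c' n (pcircOf C) (decNil (find (boolPair x y))) = true} := by exact_mod_cast hmono
    linarith
  exact_mod_cast h'

/-- **The guard holds on the signed promise**: two or more idle input wires give `|Φ| ≤ 1/2`, so `|Φ| > 1/2`
forces `n ≤ #read wires + 1 ≤ |x| + 1` (cf. `CubicDequant.guard_of_isYes`). [cite: AaronsonAmbainis2018, §3.2 and §6] -/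
theorem guard_of_half_lt_abs (I : KForrelationInstance) (hk : I.k = 2) (h : 1 / 2 < |I.value|) :
    I.n ≤ I.encode.length + 1 := by
  by_contra hlt
  push Not at hlt
  have hs := ForrMem.sR_le_length I
  have ht : 2 ≤ I.n - ForrMem.sR I := by omega
  have hval := ForrMem.value_eq I
  have hrho : idleFactor I.k = (Real.sqrt 2)⁻¹ := idleFactor_of_even (by rw [hk])
  have habs : |I.value| ≤ 1 / 2 := by
    rw [hval, abs_mul, abs_pow, hrho, abs_inv, abs_of_nonneg (Real.sqrt_nonneg 2)]
    have h1 : |ForrMem.phi0 I| ≤ 1 := abs_kForrelationValue_le_one _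
    have hr1 : (Real.sqrt 2)⁻¹ ≤ 1 := by
      rw [inv_le_one₀ (Real.sqrt_pos.2 two_pos)]
      exact Real.one_le_sqrt.2 (by norm_num)
    have hr0 : 0 ≤ (Real.sqrt 2)⁻¹ := by positivity
    have h2 : ((Real.sqrt 2)⁻¹) ^ (I.n - ForrMem.sR I) ≤ ((Real.sqrt 2)⁻¹) ^ 2 := pow_le_pow_of_le_one hr0 hr1 ht
    have hsq : ((Real.sqrt 2)⁻¹) ^ 2 = 1 / 2 := by rw [inv_pow, Real.sq_sqrt (by norm_num)]; norm_num
    calc |ForrMem.phi0 I| * (Real.sqrt 2)⁻¹ ^ (I.n - ForrMem.sR I) ≤ 1 * (1 / 2) := by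
          rw [← hsq]; exact mul_le_mul h1 h2 (by positivity) zero_le_one
      _ = 1 / 2 := one_mul _
  linarith


/-! ### From the finder of the line to certified blocks on the instance or its swap -/

/-- **The finder certifies one side.** If the finder succeeds (rows of small rank defect spanning a coset-affine
subspace, with probability `≥ 2/3`) on every promise instance whose SECOND circuit has a `⊕`-closed `V ∋ 0` of
M-defect `≤ c log₂(n+2)` on whose cosets it is affine, then on an instance with such a `V` for EITHER circuit one
block of finder coins certifies with probability `≥ 2/3`: on the instance itself (second circuit) or on its swap
(first circuit; same code length, value, degrees). [cite: Carlet2020, Prop. 54] -/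
theorem finder_certifies_side (c c' : ℕ) (find : List Bool → List Bool) (p : Polynomial ℕ)
    (hF : ∀ (I : KForrelationInstance) (hk : I.k = 2),
      Even I.n → I.IsOverB2 → (∀ i, IsDegLeFun 3 (I.C i).eval) → (3 / 5 : ℝ) ≤ |I.value| →
      (∃ V : Finset (Fin I.n → Bool), zeroVec ∈ V ∧ (∀ x ∈ V, ∀ y ∈ V, bxor x y ∈ V) ∧
        2 ^ I.n ≤ V.card ^ 2 * (I.n + 2) ^ (2 * c) ∧
        ∀ u ∈ V, ∀ v ∈ V, ∀ y, ((I.C (Fin.cast hk.symm 1)).eval y ^^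
          (I.C (Fin.cast hk.symm 1)).eval (bxor y u) ^^ (I.C (Fin.cast hk.symm 1)).eval (bxor y v) ^^
          (I.C (Fin.cast hk.symm 1)).eval (bxor y (bxor u v))) = false) →
      (2 / 3 : ℝ) ≤ uniformProb (p.eval I.encode.length)
        {y | ∃ L : List (List Bool), find (boolPair I.encode y) = encList L ∧
          I.n ≤ 2 * Module.finrank (ZMod 2) ↥(F2Elim.rowSpan I.n L) + c' * Nat.log 2 (I.n + 2) ∧
          ∀ u v : Fin I.n → Bool, (fun i => if u i then (1 : ZMod 2) else 0) ∈ F2Elim.rowSpan I.n L →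
            (fun i => if v i then (1 : ZMod 2) else 0) ∈ F2Elim.rowSpan I.n L →
          ∀ y, ((I.C (Fin.cast hk.symm 1)).eval y ^^
            (I.C (Fin.cast hk.symm 1)).eval (bxor y u) ^^ (I.C (Fin.cast hk.symm 1)).eval (bxor y v) ^^
            (I.C (Fin.cast hk.symm 1)).eval (bxor y (bxor u v))) = false})
    (I : KForrelationInstance) (hk : I.k = 2) (hn : Even I.n) (hB2 : I.IsOverB2) (hdeg : ∀ i, IsDegLeFun 3 (I.C i).eval)
    (hΦ : (3 / 5 : ℝ) ≤ |I.value|)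
    (hM : ∃ i, ∃ V : Finset (Fin I.n → Bool), zeroVec ∈ V ∧ (∀ x ∈ V, ∀ y ∈ V, bxor x y ∈ V) ∧
      2 ^ I.n ≤ V.card ^ 2 * (I.n + 2) ^ (2 * c) ∧
      ∀ u ∈ V, ∀ v ∈ V, ∀ y, ((I.C i).eval y ^^ (I.C i).eval (bxor y u) ^^ (I.C i).eval (bxor y v) ^^
        (I.C i).eval (bxor y (bxor u v))) = false) :
    2 * 2 ^ p.eval I.encode.length ≤ 3 * cnt (p.eval I.encode.length)
        {y | certOKR c' I.n (pcircOf (C₁ I hk)) (decNil (find (boolPair I.encode y))) = true} ∨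
      2 * 2 ^ p.eval I.encode.length ≤ 3 * cnt (p.eval I.encode.length)
        {y | certOKR c' I.n (pcircOf (C₀ I hk)) (decNil (find (boolPair (swapI I hk).encode y))) = true} := by
  obtain ⟨⟨v, hv⟩, V, h0, hadd, hcard, haff⟩ := hM
  have h2 : v < 2 := by rw [← hk]; exact hv
  interval_cases v
  · -- the first circuit carries the subspace: the swapped instance
    right
    have hF' := hF (swapI I hk) (swapI_k I hk) hn (isOverB2_swapI hk hB2) (isDegLeFun_swapI hk hdeg)
      (by rw [value_swapI]; exact hΦ) ⟨V, h0, hadd, hcard, haff⟩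
    rw [length_encode_swapI] at hF'
    exact two_mul_le_cnt_certOKR find hF'
  · -- the second circuit carries the subspace: the instance itself
    left
    exact two_mul_le_cnt_certOKR find (hF I hk hn hB2 hdeg hΦ ⟨V, h0, hadd, hcard, haff⟩)

end MMReadout

end Literature.Computability.QuantumComplexity

end
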